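import Mathlib
import HarnessLib
import Summits.HubbardSuperconductivity.HubbardSuperconductivity.Theorems.KLProgrammeKLRegimeSplitLegSlice
import Summits.HubbardSuperconductivity.HubbardSuperconductivity.Theorems.KLProgrammeH10TwoPointLimitFramePerturbation

/-!
# Route `KLProgramme` — crux K3 split, ENGINE child (gen 3, `KLRegimeEngineV10`): the ULTRAVIOLET leg dressing at scale `0` (defect Δ19 = T2-2's
# «Δ-UV»): entrywise bound of the cutoff covariance `C^K_{>Λ}` at zero seed, `‖entry‖ ≤ 4βL²/Λ` (so `≤ 128·βL²` at `Λ₀ = e₀ = 1/32`), and the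
# size of the counterterm vertex of an admissible frame, `|K(p)| ≤ 2·Gfr₀·|U|` (cell gate-hubbard-kl, seat hubbard-kl-k3c2-p3, row «leg-dress bar»)

Δ19 (tribunal seat T2-2, INBOX 2026-08-26T17:32:54Z; p1 g6 / k3c2-p1 confirmed; BundleV10 p460516).  At scale `0` the carrier is
`effAction ℂ C^K_{>Λ₀} (V + 𝒩_K)`: the frame `K` IS a quadratic vertex (`counterQuadratic`), and the ultraviolet covariance `C^K_{>Λ₀}` dresses the
external legs of the bare quartic vertex `U` at first order: `U·C^K_{>Λ₀}(ℓ)·(K(ℓ) + Σ^{UV}(ℓ))` per leg.  The repaired scale-`0` clauses of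
`EngineBoundsAtV7S` ((E2-v7) `PairLadderStepAtV7`, (E2′-S2 UV) `QuarticValueUVAtS2`) carry the count-free majorant `legDressBarQ G P Q U 0 4`
for it.  The two kinematic inputs of its certification are typed here (the third, the UV self-energy `Σ^{UV} = O(U)` with an absolute constant,
is the scale-`0` rung's own output):
* `klld_weight_ne_zero_radius` — the weight `w^K_Λ(k) = χ₂(t²/Λ²)` vanishes unless `t > Λ/2`, so `1/t < 2/Λ` wherever a leg is dressed;
* `klld_norm_covAboveCT_zero_seed_le` — `‖C^K_{>Λ}(X,Y)‖ ≤ βL²·(w(k_X)/t(k_X) + w(k_Y)/t(k_Y))` (the `…SplitLegSlice` pattern for ONE cutoff);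
* `klld_norm_covAboveCT_le` — hence `≤ 4βL²/Λ` for `Λ > 0`, at every label, frame, `β > 0`, `μ`, `M`; `klld_norm_covAboveCT_klE0_le`: `≤ 128·βL²`;
* `klld_abs_eval_le_of_frameOK` — an admissible frame (`FrameOK R U N μ K`: pieces `‖(Kp n)‖ ≤ Gfr₀·|U|·4^{−2n}`) has `|K(p)| ≤ 2·Gfr₀·|U|`
  EVERYWHERE (geometric sum `16/15 ≤ 2`; the sharper `j = 0` reading of p4's `norm_iteratedFDeriv_frameShift_le_of_frameOK`, without the
  `Gfr₂·U²·(N+1)` term of its `j ≤ 2` form);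
* `klld_uv_leg_dressing_le` — THE PER-LEG UV SIZE of the frame-vertex dressing: `‖C^K_{>Λ}(X,Y)‖·|K(p)| ≤ (4βL²/Λ)·(2·Gfr₀·|U|)`, i.e. `256·Gfr₀·|U|·βL²`
  at `Λ₀` — `R`-linear, which is why the scale-`0` tolerance needs the `Q`-level `legDressBarQ … 0 4` (`Q.CR·Klam² ≥ 4·256·Gfr₀ + …`, `Q` after `R`).
Pure consequences of the tree's definitions; nothing about the model beyond its free covariance is asserted.
-/

noncomputable section

namespace Summit.HubbardSuperconductivity.HubbardSuperconductivity.Theorems.KLRegimeSplit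

set_option linter.dupNamespace false -- summit = problem name (single-conjunct summit), D-0017

open Real Finset Literature.MathematicalPhysics.QuantumLattice Literature.Probability.LatticeModels
open Summit.HubbardSuperconductivity.HubbardSuperconductivity.Theorems.KLProgrammeLegKernels
open Summit.HubbardSuperconductivity.HubbardSuperconductivity.Theorems.DispersionFlow
open Summit.HubbardSuperconductivity.HubbardSuperconductivity.Theorems.PerturbedFermiCurve (sum_four_zpow_le_two)

section Model

variable {L M : ℕ}

/-- **Support of ONE cutoff**: if the weight of the fields above `Λ > 0` does not vanish at `k`, then `Λ²/4 < t(k)²` and `1/t(k) < 2/Λ`. -/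
theorem klld_weight_ne_zero_radius {β : ℝ} (μ : ℝ) (K : TrigPolyC4v) {Λ : ℝ} (hΛ : 0 < Λ) (k : FreqMomentum L M)
    (h : hubbardCutoffWeightCT L M β μ K Λ k ≠ 0) :
    Λ ^ 2 / 4 < klFreqRadius L M β μ K k ^ 2 ∧ (klFreqRadius L M β μ K k)⁻¹ < 2 / Λ := by
  rw [klld_weight_eq_salmhofer_radius] at h
  set r := klFreqRadius L M β μ K k ^ 2 with hr
  have hr0 : 0 ≤ r := sq_nonneg _
  have hlo : Λ ^ 2 / 4 < r := by
    by_contra hle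
    have h1 : r / Λ ^ 2 ≤ 1 / 4 := by
      rw [div_le_iff₀ (by positivity)]; linarith [not_lt.mp hle]
    exact h (salmhoferCutoff_of_le h1)
  refine ⟨hlo, ?_⟩
  have hhalf : Λ / 2 < klFreqRadius L M β μ K k := by
    have h0 : 0 ≤ klFreqRadius L M β μ K k := Real.sqrt_nonneg _
    nlinarith [hlo, h0, hΛ]
  have hpos : 0 < klFreqRadius L M β μ K k := lt_trans (by positivity) hhalf
  rw [inv_eq_one_div, div_lt_div_iff₀ hpos hΛ]
  linarith

/-- **The zero-seed cutoff covariance, entrywise**: for `β > 0`, every frame, scale `Λ` and labels,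
`‖C^K_{>Λ}(X, Y)‖ ≤ βL²·(w^K_Λ(k_X)/t(k_X) + w^K_Λ(k_Y)/t(k_Y))`. -/
theorem klld_norm_covAboveCT_zero_seed_le [NeZero L] {β : ℝ} (hβ : 0 < β) (μ : ℝ) (K : TrigPolyC4v) (Λ : ℝ)
    (X Y : HubbardFieldIdx L M) :
    ‖hubbardCovAboveCT L M β μ 0 K Λ X Y‖ ≤
      β * (L : ℝ) ^ 2 *
        (hubbardCutoffWeightCT L M β μ K Λ (momentumOf L M X) * (klFreqRadius L M β μ K (momentumOf L M X))⁻¹ +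
          hubbardCutoffWeightCT L M β μ K Λ (momentumOf L M Y) * (klFreqRadius L M β μ K (momentumOf L M Y))⁻¹) := by
  set wX := hubbardCutoffWeightCT L M β μ K Λ (momentumOf L M X) with hwX
  set wY := hubbardCutoffWeightCT L M β μ K Λ (momentumOf L M Y) with hwY
  set tX := klFreqRadius L M β μ K (momentumOf L M X)
  set tY := klFreqRadius L M β μ K (momentumOf L M Y)
  set C := hubbardCovarianceCT L M β μ 0 K X Y with hC
  have hβL : 0 ≤ β * (L : ℝ) ^ 2 := by positivity
  have hwX0 : 0 ≤ wX := (salmhoferCutoff_mem_Icc _).1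
  have hwY0 : 0 ≤ wY := (salmhoferCutoff_mem_Icc _).1
  have hentry : hubbardCovAboveCT L M β μ 0 K Λ X Y = (((wX + wY) / 2 : ℝ) : ℂ) * C := by
    simp only [hubbardCovAboveCT, Matrix.of_apply, hwX, hwY, hC]
  have hCX : ‖C‖ ≤ 2 * (β * (L : ℝ) ^ 2) * tX⁻¹ := by
    rw [hC, hubbardCovarianceCT, Matrix.of_apply, norm_neg]
    exact klld_norm_hubbardTwoPointCT_zero_seed_le hβ μ K X Y
  have hCY : ‖C‖ ≤ 2 * (β * (L : ℝ) ^ 2) * tY⁻¹ := by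
    rw [hC, hubbardCovarianceCT, Matrix.of_apply, norm_neg]
    exact klld_norm_hubbardTwoPointCT_zero_seed_le_snd hβ μ K X Y
  rw [hentry, norm_mul, Complex.norm_real, Real.norm_eq_abs, abs_of_nonneg (by positivity)]
  calc (wX + wY) / 2 * ‖C‖ = wX / 2 * ‖C‖ + wY / 2 * ‖C‖ := by ring
    _ ≤ wX / 2 * (2 * (β * (L : ℝ) ^ 2) * tX⁻¹) + wY / 2 * (2 * (β * (L : ℝ) ^ 2) * tY⁻¹) := by gcongr
    _ = β * (L : ℝ) ^ 2 * (wX * tX⁻¹ + wY * tY⁻¹) := by ring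

/-- One cutoff at one label: `w^K_Λ(k)/t(k) ≤ 2/Λ` (`w ∈ [0,1]`; where `w ≠ 0`, `1/t < 2/Λ`). -/
theorem klld_weight_div_radius_le (β μ : ℝ) (K : TrigPolyC4v) {Λ : ℝ} (hΛ : 0 < Λ) (k : FreqMomentum L M) :
    hubbardCutoffWeightCT L M β μ K Λ k * (klFreqRadius L M β μ K k)⁻¹ ≤ 2 / Λ := by
  by_cases h : hubbardCutoffWeightCT L M β μ K Λ k = 0
  · rw [h, zero_mul]; positivity
  · have hw := salmhoferCutoff_mem_Icc ((matsubaraFreq β M k.1 ^ 2 + nambuXiCT L μ K k.2 ^ 2) / Λ ^ 2)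
    have hw1 : hubbardCutoffWeightCT L M β μ K Λ k ≤ 1 := hw.2
    have hw0 : 0 ≤ hubbardCutoffWeightCT L M β μ K Λ k := hw.1
    have hlt := (klld_weight_ne_zero_radius μ K hΛ k h).2
    have hinv : 0 ≤ (klFreqRadius L M β μ K k)⁻¹ := inv_nonneg.mpr (Real.sqrt_nonneg _)
    calc _ ≤ 1 * (klFreqRadius L M β μ K k)⁻¹ := mul_le_mul_of_nonneg_right hw1 hinv
      _ ≤ 2 / Λ := by rw [one_mul]; exact hlt.le

/-- **The cutoff covariance above `Λ > 0`, entrywise**: `‖C^K_{>Λ}(X, Y)‖ ≤ 4βL²/Λ` — every frame, `β > 0`, `μ`, `M`, all labels. -/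
theorem klld_norm_covAboveCT_le [NeZero L] {β : ℝ} (hβ : 0 < β) (μ : ℝ) (K : TrigPolyC4v) {Λ : ℝ} (hΛ : 0 < Λ)
    (X Y : HubbardFieldIdx L M) : ‖hubbardCovAboveCT L M β μ 0 K Λ X Y‖ ≤ 4 * (β * (L : ℝ) ^ 2) / Λ := by
  have h := klld_norm_covAboveCT_zero_seed_le hβ μ K Λ X Y
  have hX := klld_weight_div_radius_le β μ K hΛ (momentumOf L M X)
  have hY := klld_weight_div_radius_le β μ K hΛ (momentumOf L M Y)
  have hβL : 0 ≤ β * (L : ℝ) ^ 2 := by positivity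
  calc _ ≤ β * (L : ℝ) ^ 2 * (2 / Λ + 2 / Λ) := h.trans (by gcongr)
    _ = 4 * (β * (L : ℝ) ^ 2) / Λ := by ring

/-- **At the ultraviolet end of the infrared region `Λ₀ = klScale klE0 0 = e₀ = 1/32`**: `‖C^K_{>Λ₀}(X, Y)‖ ≤ 128·βL²`. -/
theorem klld_norm_covAboveCT_klE0_le [NeZero L] {β : ℝ} (hβ : 0 < β) (μ : ℝ) (K : TrigPolyC4v) (X Y : HubbardFieldIdx L M) :
    ‖hubbardCovAboveCT L M β μ 0 K (klScale klE0 0) X Y‖ ≤ 128 * (β * (L : ℝ) ^ 2) := by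
  have h0 : klScale klE0 0 = 1 / 32 := by simp [klScale, klE0]
  have h := klld_norm_covAboveCT_le hβ μ K (klth_klScale_pos 0) X Y
  rw [h0] at h ⊢
  have : 4 * (β * (L : ℝ) ^ 2) / (1 / 32) = 128 * (β * (L : ℝ) ^ 2) := by ring
  linarith

end Model

/-! ## The counterterm vertex of an admissible frame is `O(Gfr₀·U)` everywhere -/

/-- **The sup size of an admissible frame**: `FrameOK R U N μ K` gives `|K(p)| ≤ 2·Gfr₀·|U|` at every `p` (pieces `Kp n` of sup size
`Gfr 0·uPow 0 U·4^{−2n} = Gfr₀·|U|·4^{−2n}`, geometric sum `≤ 16/15 ≤ 2`). -/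
theorem klld_abs_eval_le_of_frameOK {R : RenConsts} (hR0 : 0 ≤ R.Gfr 0) {U : ℝ} {N : ℕ} {μ : ℝ} {K : TrigPolyC4v}
    (hK : FrameOK R U N μ K) (p : Fin 2 → ℝ) : |K.eval p| ≤ 2 * R.Gfr 0 * |U| := by
  obtain ⟨-, Kp, hsum, hS⟩ := hK
  rw [hsum p]
  refine (Finset.abs_sum_le_sum_abs _ _).trans ?_
  have hpiece : ∀ n ∈ range (N + 1), |(Kp n).eval p| ≤ R.Gfr 0 * |U| * (4 : ℝ) ^ ((((0 : ℕ) : ℤ) - 2) * n) := by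
    intro n hn
    have hn' : n ≤ N := Nat.lt_succ_iff.mp (mem_range.mp hn)
    have h := hS n hn' 0 (by norm_num) (WithLp.toLp 2 p)
    rw [norm_iteratedFDeriv_zero] at h
    simpa [evalM, Real.norm_eq_abs, uPow] using h
  refine (sum_le_sum hpiece).trans ?_
  rw [← Finset.mul_sum]
  have hgeom := sum_four_zpow_le_two (j := 0) (by norm_num) N
  have h0 : 0 ≤ R.Gfr 0 * |U| := mul_nonneg hR0 (abs_nonneg U)
  calc R.Gfr 0 * |U| * ∑ n ∈ range (N + 1), (4 : ℝ) ^ ((((0 : ℕ) : ℤ) - 2) * n) ≤ R.Gfr 0 * |U| * 2 :=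
        mul_le_mul_of_nonneg_left hgeom h0
    _ = 2 * R.Gfr 0 * |U| := by ring

/-- The same on `Momentum` (`evalM`). -/
theorem klld_abs_evalM_le_of_frameOK {R : RenConsts} (hR0 : 0 ≤ R.Gfr 0) {U : ℝ} {N : ℕ} {μ : ℝ} {K : TrigPolyC4v}
    (hK : FrameOK R U N μ K) (q : Momentum) : |evalM K q| ≤ 2 * R.Gfr 0 * |U| :=
  klld_abs_eval_le_of_frameOK hR0 hK _

/-- The frame vertex read at a lattice momentum of the torus: `|K(p_k⃗)| ≤ 2·Gfr₀·|U|`. -/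
theorem klld_abs_eval_latticeMomentum_le_of_frameOK {L : ℕ} {R : RenConsts} (hR0 : 0 ≤ R.Gfr 0) {U : ℝ} {N : ℕ} {μ : ℝ}
    {K : TrigPolyC4v} (hK : FrameOK R U N μ K) (k : TorusSite 2 L) : |K.eval (latticeMomentum L k)| ≤ 2 * R.Gfr 0 * |U| :=
  klld_abs_eval_le_of_frameOK hR0 hK _

section Model

variable {L M : ℕ} [NeZero L]

/-- **THE PER-LEG ULTRAVIOLET DRESSING SIZE (frame-vertex part)**: for an admissible frame and `β, Λ > 0`, on every pair of labels,
`‖C^K_{>Λ}(X, Y)‖ · |K(p)| ≤ (4βL²/Λ)·(2·Gfr₀·|U|)` — at `Λ₀ = e₀`: `≤ 256·Gfr₀·|U|·βL²`; `R`-linear in size, hence the `Q`-level scale-`0`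
majorant `legDressBarQ G P Q U 0 4` of `EngineBoundsAtV7S` (Δ19). -/
theorem klld_uv_leg_dressing_le {β : ℝ} (hβ : 0 < β) (μ : ℝ) {R : RenConsts} (hR0 : 0 ≤ R.Gfr 0) {U : ℝ} {N : ℕ} {ν : ℝ}
    {K : TrigPolyC4v} (hK : FrameOK R U N ν K) {Λ : ℝ} (hΛ : 0 < Λ) (X Y : HubbardFieldIdx L M) (p : Fin 2 → ℝ) :
    ‖hubbardCovAboveCT L M β μ 0 K Λ X Y‖ * |K.eval p| ≤ 4 * (β * (L : ℝ) ^ 2) / Λ * (2 * R.Gfr 0 * |U|) :=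
  mul_le_mul (klld_norm_covAboveCT_le hβ μ K hΛ X Y) (klld_abs_eval_le_of_frameOK hR0 hK p) (abs_nonneg _) (by positivity)

/-- The same at `Λ₀ = klScale klE0 0`: `≤ 256·Gfr₀·|U|·βL²`. -/
theorem klld_uv_leg_dressing_klE0_le {β : ℝ} (hβ : 0 < β) (μ : ℝ) {R : RenConsts} (hR0 : 0 ≤ R.Gfr 0) {U : ℝ} {N : ℕ} {ν : ℝ}
    {K : TrigPolyC4v} (hK : FrameOK R U N ν K) (X Y : HubbardFieldIdx L M) (p : Fin 2 → ℝ) :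
    ‖hubbardCovAboveCT L M β μ 0 K (klScale klE0 0) X Y‖ * |K.eval p| ≤ 256 * R.Gfr 0 * |U| * (β * (L : ℝ) ^ 2) := by
  have h := mul_le_mul (klld_norm_covAboveCT_klE0_le hβ μ K X Y) (klld_abs_eval_le_of_frameOK hR0 hK p) (abs_nonneg _)
    (by positivity)
  linarith

end Model

end Summit.HubbardSuperconductivity.HubbardSuperconductivity.Theorems.KLRegimeSplit

end
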